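import Summits.QuantumFields.YangMills.Theorems.DiagonalMirrorRPRWilsonDiagonalModelOpenLink
import Literature.Analysis.OperatorTheory.PositiveKernelTransferOperator

/-!
# Crux `WeakCouplingHypercubicLimitRP` (stmt-QuantumFields-27398) / aside `DiagonalMirrorRPR` (stmt-QuantumFields-10604), door B,
# construction F1_diag — PAIRING LAYER, step P3e: GRAM KERNELS ARE POSITIVE SEMI-DEFINITE (`𝒲_f = 𝒯_f† 𝒯_f ≥ 0`)

Helper file (`--supports stmt-QuantumFields-27398 --as helper`) of the hand `hand-10604-wilsonDiagModel-2` (docket director-ym O4 WORD 16 (1) /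
28, step P3 of hand-1's ROADMAP-F1diag v4 §1⅞); it closes nothing by itself.

WHAT.
* §1 `integral_mul_integral_gram_mul_eq` (generic, finite measures): for a bounded strongly measurable `H : Z → X → ℝ` and the Gram kernel
  `K(x,y) = ∫ H(z,x) H(z,y) dν(z)`, every integrable `φ` satisfies `∫ φ(x) ∫ K(x,y) φ(y) dμ dμ = ∫ (∫ H(z,x) φ(x) dμ)² dν ≥ 0`
  (two Fubini interchanges) — `integral_mul_integral_gram_mul_nonneg`;
* §2 ★ **`inner_blockKernelOp_self_nonneg`**: for the block kernel `blockKernel f = ∫ halfBlockT(v₀,·) halfBlockT(v₀,·) dμ̃(v₀)` of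
  `…OpenLink` and ANY bounded operator `𝒲` on `L²(μ̃)` given a.e. by it, `0 ≤ ⟪φ, 𝒲 φ⟫` — the Gram weights of the pairing layer are non-negative
  (this is where reflection positivity of the Wilson action enters the model: the two half blocks are the same function, `…BlockChain`).

HONEST FRAMING: bookkeeping of the pairing layer; `wilsonDiagonalModel` is NOT landed here; no letter is proved; D1, ⟨27398⟩, S6i and the aside
⟨10604⟩ are OPEN; nothing here bears on the summit; the Yang–Mills mass gap is NOT proved here or anywhere in the tree.  No definition, no
instance, no notation, `autoImplicit false`.

References: K. Osterwalder, E. Seiler, Ann. Phys. 110 (1978) §2–3; M. Reed, B. Simon, *Methods of Modern Mathematical Physics I* (1980) §VI.6.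
-/

set_option autoImplicit false

noncomputable section

open scoped BigOperators ENNReal RealInnerProductSpace
open MeasureTheory Function
open Literature.MathematicalPhysics.QuantumLattice Literature.MathematicalPhysics.QuantumFieldTheory
open Summit.QuantumFields.YangMills.Cruxes.DiagonalMirrorRPR.ParityBridgeColdTraces

namespace Summit.QuantumFields.YangMills.Cruxes.DiagonalMirrorRPR.SignTwistedDiagonalTrace.WilsonDiagonal

/-! ## §1 Gram kernels: `∫ φ(x) ∫ K(x,y) φ(y) = ∫ (∫ H(z,x) φ(x))²` -/

section Gram

variable {X Z : Type*} [MeasurableSpace X] [MeasurableSpace Z] {μ : Measure X} {ν : Measure Z}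
  [IsFiniteMeasure μ] [IsFiniteMeasure ν]

/-- **Gram identity.**  For a bounded strongly measurable `H : Z → X → ℝ` on finite measure spaces and an integrable `φ`:
`∫ φ(x) (∫ (∫ H(z,x) H(z,y) dν(z)) φ(y) dμ(y)) dμ(x) = ∫ (∫ H(z,x) φ(x) dμ(x))² dν(z)`. [folklore] -/
theorem integral_mul_integral_gram_mul_eq {H : Z → X → ℝ} (hH : StronglyMeasurable (uncurry H)) {C : ℝ}
    (hC : ∀ z x, |H z x| ≤ C) {φ : X → ℝ} (hφ : Integrable φ μ) :
    ∫ x, φ x * ∫ y, (∫ z, H z x * H z y ∂ν) * φ y ∂μ ∂μ = ∫ z, (∫ x, H z x * φ x ∂μ) ^ 2 ∂ν := by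
  -- measurability / integrability bookkeeping
  have hHm : Measurable (uncurry H) := hH.measurable
  have hHz : ∀ z, Measurable (H z) := fun z => hHm.comp (measurable_const.prodMk measurable_id)
  have hφm : AEStronglyMeasurable φ μ := hφ.aestronglyMeasurable
  -- `g z = ∫ H z y φ y dμ`
  set g : Z → ℝ := fun z => ∫ y, H z y * φ y ∂μ with hg
  have hgb : ∀ z, |g z| ≤ C * ∫ y, |φ y| ∂μ := fun z => by
    rw [hg]; dsimp only
    rw [← integral_const_mul]
    refine (abs_integral_le_integral_abs).trans (integral_mono_of_nonneg (ae_of_all _ fun y => abs_nonneg _)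
      (hφ.abs.const_mul C) (ae_of_all _ fun y => ?_))
    dsimp only
    rw [abs_mul]
    exact mul_le_mul_of_nonneg_right (hC z y) (abs_nonneg _)
  -- joint integrability of `(z, y) ↦ H z y * φ y` on `ν ⊗ μ`
  have hI1 : Integrable (fun p : Z × X => H p.1 p.2 * φ p.2) (ν.prod μ) := by
    have h1 : Integrable (fun p : Z × X => φ p.2) (ν.prod μ) := hφ.comp_snd ν
    have h2 := h1.bdd_mul (c := C) hH.aestronglyMeasurable (ae_of_all _ fun p => by
      rw [Real.norm_eq_abs]; exact hC p.1 p.2)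
    exact h2.congr (ae_of_all _ fun p => by simp [uncurry])
  have hgm : AEStronglyMeasurable g ν := by
    have h := hI1.aestronglyMeasurable.integral_prod_right' (μ := ν) (ν := μ)
    exact h
  -- (1) inner interchange: `∫_y (∫_z H z x H z y) φ y = ∫_z H z x g z`
  have hinner : ∀ x, ∫ y, (∫ z, H z x * H z y ∂ν) * φ y ∂μ = ∫ z, H z x * g z ∂ν := by
    intro x
    have hI : Integrable (fun p : Z × X => H p.1 x * (H p.1 p.2 * φ p.2)) (ν.prod μ) := by
      refine (hI1.bdd_mul (c := C) ((hHm.comp (measurable_fst.prodMk measurable_const)).aestronglyMeasurable)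
        (ae_of_all _ fun p => ?_))
      rw [Real.norm_eq_abs]; exact hC p.1 x
    have h1 : ∫ y, (∫ z, H z x * H z y ∂ν) * φ y ∂μ = ∫ y, ∫ z, H z x * (H z y * φ y) ∂ν ∂μ := by
      refine integral_congr_ae (ae_of_all _ fun y => ?_)
      dsimp only
      rw [← integral_mul_const]
      refine integral_congr_ae (ae_of_all _ fun z => ?_)
      ring
    have hI' : Integrable (uncurry fun (y : X) (z : Z) => H z x * (H z y * φ y)) (μ.prod ν) := by
      have h := hI.swap
      exact h.congr (ae_of_all _ fun p => by simp [uncurry])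
    rw [h1, integral_integral_swap hI']
    refine integral_congr_ae (ae_of_all _ fun z => ?_)
    dsimp only
    rw [integral_const_mul]
  -- (2) outer interchange
  have hI2 : Integrable (fun p : X × Z => φ p.1 * (H p.2 p.1 * g p.2)) (μ.prod ν) := by
    have h1 : Integrable (fun p : X × Z => φ p.1) (μ.prod ν) := hφ.comp_fst ν
    have hm : AEStronglyMeasurable (fun p : X × Z => H p.2 p.1 * g p.2) (μ.prod ν) :=
      ((hHm.comp (measurable_snd.prodMk measurable_fst)).aestronglyMeasurable).mul (hgm.comp_snd)
    refine (h1.bdd_mul (c := C * (C * ∫ y, |φ y| ∂μ)) hm (ae_of_all _ fun p => ?_)).congr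
      (ae_of_all _ fun p => by ring)
    rw [norm_mul, Real.norm_eq_abs, Real.norm_eq_abs]
    exact mul_le_mul (hC _ _) (hgb _) (abs_nonneg _) ((abs_nonneg _).trans (hC p.2 p.1))
  calc ∫ x, φ x * ∫ y, (∫ z, H z x * H z y ∂ν) * φ y ∂μ ∂μ
      = ∫ x, ∫ z, φ x * (H z x * g z) ∂ν ∂μ := by
        refine integral_congr_ae (ae_of_all _ fun x => ?_)
        dsimp only
        rw [hinner x, ← integral_const_mul]
    _ = ∫ z, ∫ x, φ x * (H z x * g z) ∂μ ∂ν :=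
        integral_integral_swap (hI2.congr (ae_of_all _ fun p => by simp [uncurry]))
    _ = ∫ z, (∫ x, H z x * φ x ∂μ) ^ 2 ∂ν := by
        refine integral_congr_ae (ae_of_all _ fun z => ?_)
        dsimp only
        have h3 : ∫ x, φ x * (H z x * g z) ∂μ = (∫ x, H z x * φ x ∂μ) * g z := by
          rw [← integral_mul_const]
          refine integral_congr_ae (ae_of_all _ fun x => ?_)
          ring
        rw [h3, hg, sq]

/-- **Gram kernels are positive semi-definite** (integral form): `0 ≤ ∫ φ(x) ∫ K(x,y) φ(y)` for `K(x,y) = ∫ H(z,x) H(z,y) dν(z)`. [folklore] -/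
theorem integral_mul_integral_gram_mul_nonneg {H : Z → X → ℝ} (hH : StronglyMeasurable (uncurry H)) {C : ℝ}
    (hC : ∀ z x, |H z x| ≤ C) {φ : X → ℝ} (hφ : Integrable φ μ) :
    0 ≤ ∫ x, φ x * ∫ y, (∫ z, H z x * H z y ∂ν) * φ y ∂μ ∂μ := by
  rw [integral_mul_integral_gram_mul_eq hH hC hφ]
  exact integral_nonneg fun z => sq_nonneg _

end Gram

/-! ## §2 ★ The block kernel operator is positive semi-definite -/

section BlockPSD

variable {S : ℕ} [NeZero S] {G : Type} [Group G] {Nc : ℕ} (ρ : G →* Matrix (Fin Nc) (Fin Nc) ℂ)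
variable [TopologicalSpace G] [IsTopologicalGroup G] [CompactSpace G] [MeasurableSpace G] [BorelSpace G]
  [SecondCountableTopology G]

/-- ★ **`⟪φ, 𝒲_f φ⟫ ≥ 0`**: any bounded operator on `L²(μ̃)` given a.e. by the block kernel of a bounded measurable observable `f` of depth
`e + 1` is positive semi-definite — the block kernel is the Gram kernel of `halfBlockT` (`𝒲_f = 𝒯_f† 𝒯_f`). -/
theorem inner_blockKernelOp_self_nonneg (hρ : Continuous ρ) {β : ℝ} (hβ : 0 ≤ β) {M : ℝ}
    (hM : ∀ (Y : HalfCfg S S G) (j : Fin (featDim S Nc)), |bondVec ρ Y j| ≤ M) {e : ℕ}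
    {f : (Fin (e + 1) → HalfCfg S S G) → (Fin (e + 1) → HalfCfg S S G) → ℝ} (hf : Measurable (uncurry f))
    {B : ℝ} (hB : ∀ Y X, |f Y X| ≤ B)
    {W : Lp ℝ 2 (tMeasure S G Nc β M) →L[ℝ] Lp ℝ 2 (tMeasure S G Nc β M)}
    (hW : ∀ φ : Lp ℝ 2 (tMeasure S G Nc β M), (W φ : ℕ × HalfCfg S S G → ℝ) =ᵐ[tMeasure S G Nc β M]
      fun x => ∫ y, blockKernel S G Nc ρ β M f x y * φ y ∂(tMeasure S G Nc β M))
    (φ : Lp ℝ 2 (tMeasure S G Nc β M)) : 0 ≤ ⟪φ, W φ⟫ := by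
  haveI := isFiniteMeasure_tMeasure (S := S) (G := G) (Nc := Nc) hβ M
  rw [Literature.Analysis.OperatorTheory.inner_kernelOp_eq_integral hW φ φ]
  obtain ⟨C, hC0, hC⟩ := exists_abs_openLink_le ρ hρ β hM
  obtain ⟨CT, hCT0, hCT⟩ := exists_abs_halfBlockT_le (S := S) (Nc := Nc) ρ hβ M hC0.le hC hB (e := e)
  have hH : StronglyMeasurable (uncurry fun (v₀ x : ℕ × HalfCfg S S G) => halfBlockT S G Nc ρ β M f v₀ x) :=
    (measurable_halfBlockT (S := S) ρ hρ hβ M hf).stronglyMeasurable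
  have h := integral_mul_integral_gram_mul_nonneg (μ := tMeasure S G Nc β M) (ν := tMeasure S G Nc β M) hH
    (fun v₀ x => hCT v₀ x) ((Lp.memLp φ).integrable one_le_two)
  unfold blockKernel
  exact h

end BlockPSD

end Summit.QuantumFields.YangMills.Cruxes.DiagonalMirrorRPR.SignTwistedDiagonalTrace.WilsonDiagonal

end
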